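/-
Copyright (c) 2026 the pub-hodgecm-mathlib formalisation cell (harness21).  Prover seat hodgecm-mathlib-K2E2-p12 (g5): Track B «K2-LIT», ENGINE E1,
h413 = stmt-HodgeConjecture-24833; (q10) «R7₃-SCALAR» FILE 3, brick (3-iii-a) «LOCAL HEIGHT DICTIONARY» (the local factor of ★ `AdelicProductIntegral` at `ι = Fin 3`).
-/
import Summits.HodgeConjecture.HodgeConjecture.Theorems.K2E1IntertwiningLocalFactorU3HeightSplit   -- ★ (this seat): split pointwise transport; brings ★ `…U3Height` (inert), `quadraticLocalEquiv`, `LocalRing`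
import Summits.HodgeConjecture.HodgeConjecture.Theorems.K2E1IntertwiningLocalMeanInertU3          -- ★ (this seat): `integral_inertCell_pi_eq_localScalar`, `integrable_inertCell_pi`
import HarnessLib

/-!
# K2·E1 — `K2E1IntertwiningLocalHeightU3` ((q10) «R7₃-SCALAR» FILE 3, brick (3-iii-a)): THE LOCAL HEIGHT FACTOR `Q_v(a, b, t) = ∏_{w∣v} max(1, ‖X_w‖, ‖Z_w‖)` OF THE `U(2,1)`
# INTERTWINING INTEGRAND IN BASE COORDINATES — continuity, the value `1` on `𝒪_v³`, and at an inert unramified place the local mean `∫ Q_v^{−σ} d(ν⊗ν⊗ν) = ν(𝒪_v)³·[FILE 1's factor at ε_v = −1]`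

Track B ∕ K2-LIT, crux h413 = `stmt-HodgeConjecture-24833`, route of record `HCCMUnconditional`; cell `hodgecm-mathlib`, squad K2, ENGINE E1 (campaign «EIS-RANK-ONE», R7 at
`N = 3`; FILE 3 census 2026-09-04T08:25Z, dealer K2E1-plan (g5) «=» 08:27Z).  THEOREMS ONLY (no `def`, no instance, no notation, no named-fact hypothesis, no `sorry`; default
heartbeats); lane `--supports stmt-HodgeConjecture-24833 --as helper` (count-neutral).  Currency: generic quadratic `E ∕ F`, `c`, `δ` (`c δ = −δ ≠ 0`, `δ² = d`), a finite place `v`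
of `F`, `Ψ_v = quadraticLocalEquiv E v c hcδ hδ`, and on `Fin 3 → F_v` (the local factor space of ★ `AdelicProductIntegral`, `ι = Fin 3`) the LOCAL HEIGHT
  `Q_v(p) := ∏_{w ∣ v} max(1, ‖Ψ_v(p₀, p₁)_w‖, ‖Z(p)_w‖)`,  `Z(p) := ι_v p₂ · δ − ι_v(½)·Ψ_v(p₀,p₁)·σΨ_v(p₀,p₁)`
(always written out; `‖·‖ = normAbs`), whose `−σ`-th power is the `v`-factor of E1's flat section `H^σ` along the Heisenberg chart read in the basis `{1, δ}` (★ (a2)₃, ★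
`K2E1FiniteAdeleBasisTransport.one_delta_transport_apply`).
* §1 **`continuous_localHeight_rpow`** — `p ↦ Q_v(p)^{−σ}` is continuous (every place `v`): the `hcont` of ★ `AdelicProductIntegral.hasProd_localIntegral_of_integrable`.
* §2 INERT UNRAMIFIED `v ∤ 2`, `δ` a unit, `q_w = q_v²`: **`localHeight_rpow_eq_inertCell`** — `Q_v(p)^{−σ} = max(1, max(‖p₀‖,‖p₁‖)², ‖p₂‖)^{−2σ}` (★ `max_one_norm_height_eq_sq`, one place above
  `v`); hence **`localHeight_eq_one_of_mem_integers_of_nonsplit`** (`Q_v = 1` on `𝒪_v³` — the `hf1` of ★ `AdelicProductIntegral`), **`integrable_localHeight_rpow_of_nonsplit`** and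
  **`integral_localHeight_rpow_eq_localScalar_of_nonsplit`**: `∫ Q_v^{−σ} d(ν⊗ν⊗ν) = ν(𝒪_v)³·[(1−q^{−σ})(1−εq^{−σ})(1−εq^{−(2σ−1)})]∕[(1−q^{−(σ−1)})(1−εq^{−(σ−1)})(1−εq^{−(2σ−2)})]` at `ε = −1`
  (★ p858600) — the `v`-factor of ★ FILE 1 `hasProd_localScalar_three` with `ε_v = −1` (★ p858536).
* §3 SPLIT `v ∤ 2`, `δ` a unit: **`localHeight_rpow_eq_gl3_of_split`** — `Q_v(p)^{−σ}` is the Gindikin–Karpelevich integrand at `Φ(p)` (★ p858552), and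
  **`localHeight_eq_one_of_mem_integers_of_split`** (`Q_v = 1` on `𝒪_v³`).  (The split local MEAN waits for (3-ii) `K2E1IntertwiningLocalMeanSplitU3`, K2-defs1 (g5).)
HONEST LABEL: HC_CM is proved only modulo the 7 printed citations (2 remaining named inputs: hLiu418 = `stmt-HodgeConjecture-24832`, h413 = `stmt-HodgeConjecture-24833`) until rung 0
closes; this file asserts no named fact and closes no socket; count-neutral.

## References
* [Langlands1971] R. P. Langlands, *Euler Products* (1971): §3.
* [TateThesis1967] J. Tate, in Cassels–Fröhlich (1967), Ch. XV §3.3.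
* [MoeglinWaldspurger1995] C. Mœglin, J.-L. Waldspurger, *Spectral Decomposition and Eisenstein Series* (1995): II.1.7, IV.1.11.
-/

set_option autoImplicit false
set_option linter.dupNamespace false -- the mandated namespace repeats `HodgeConjecture.HodgeConjecture`

noncomputable section

open MeasureTheory NumberField IsDedekindDomain
open scoped NNReal
open Literature.NumberTheory.Automorphic Literature.NumberTheory.Automorphic.UnitaryGroup
open Literature.NumberTheory.GaloisRepresentations.IsNonarchimedeanLocalField
open Literature.NumberTheory.Automorphic.LocalFieldHaar (continuous_normAbs)
open Literature.NumberTheory.GelbartRogawski1991.UnitaryDualPair.LocalSplitting (splitSqrt)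
open Summit.HodgeConjecture.HodgeConjecture.Cruxes.H413.K2E1IntertwiningLocalFactorU3Height
open Summit.HodgeConjecture.HodgeConjecture.Cruxes.H413.K2E1IntertwiningLocalFactorU3HeightSplit
open Summit.HodgeConjecture.HodgeConjecture.Cruxes.H413.K2E1IntertwiningLocalMeanInertU3

namespace Summit.HodgeConjecture.HodgeConjecture.Cruxes.H413.K2E1IntertwiningLocalHeightU3

variable {F : Type} [Field F] [NumberField F] (E : Type) [Field E] [NumberField E] [Algebra F E]
  [Algebra.IsQuadraticExtension F E] (c : E ≃ₐ[F] E) {δ : E} (hcδ : c δ = -δ) (hδ : δ ≠ 0) {d : F}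
  (hd : δ * δ = algebraMap F E d) (v : HeightOneSpectrum (𝓞 F)) (w : PlacesOver E v)

/-! ## §1 Continuity of the local factor `p ↦ Q_v(p)^{−σ}` -/

/-- **`p ↦ Q_v(p)^{−σ}` IS CONTINUOUS on `Fin 3 → F_v`** (`ι_w`, `σ = c ⊗ 1` are continuous ring maps, `‖·‖` is continuous, `Q_v ≥ 1`). [cite: TateThesis1967, §3.3] -/
theorem continuous_localHeight_rpow (σ : ℝ) :
    Continuous fun p : Fin 3 → v.adicCompletion F =>
      (∏ w' : PlacesOver E v, max 1 (max ((normAbs (w'.1.adicCompletion E) (quadraticLocalEquiv E v c hcδ hδ (p 0, p 1) w') : ℝ≥0) : ℝ)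
        ((normAbs (w'.1.adicCompletion E) ((toLocalRing E v (p 2) * algebraMap E (LocalRing E v) δ -
          toLocalRing E v 2⁻¹ * (quadraticLocalEquiv E v c hcδ hδ (p 0, p 1) * conjLocal E c v (quadraticLocalEquiv E v c hcδ hδ (p 0, p 1)))) w') : ℝ≥0) : ℝ))) ^ (-σ) := by
  have hΨ : Continuous fun p : Fin 3 → v.adicCompletion F => quadraticLocalEquiv E v c hcδ hδ (p 0, p 1) :=
    (quadraticLocalEquiv E v c hcδ hδ).continuous.comp ((continuous_apply 0).prodMk (continuous_apply 1))
  have hZ : Continuous fun p : Fin 3 → v.adicCompletion F => toLocalRing E v (p 2) * algebraMap E (LocalRing E v) δ -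
      toLocalRing E v 2⁻¹ * (quadraticLocalEquiv E v c hcδ hδ (p 0, p 1) * conjLocal E c v (quadraticLocalEquiv E v c hcδ hδ (p 0, p 1))) :=
    (((continuous_toLocalRing E v).comp (continuous_apply 2)).mul continuous_const).sub
      (continuous_const.mul (hΨ.mul ((continuous_conjLocal E c v).comp hΨ)))
  have hQ : Continuous fun p : Fin 3 → v.adicCompletion F =>
      ∏ w' : PlacesOver E v, max 1 (max ((normAbs (w'.1.adicCompletion E) (quadraticLocalEquiv E v c hcδ hδ (p 0, p 1) w') : ℝ≥0) : ℝ)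
        ((normAbs (w'.1.adicCompletion E) ((toLocalRing E v (p 2) * algebraMap E (LocalRing E v) δ -
          toLocalRing E v 2⁻¹ * (quadraticLocalEquiv E v c hcδ hδ (p 0, p 1) * conjLocal E c v (quadraticLocalEquiv E v c hcδ hδ (p 0, p 1)))) w') : ℝ≥0) : ℝ)) := by
    refine continuous_finsetProd _ fun w' _ => continuous_const.max (Continuous.max ?_ ?_)
    · exact NNReal.continuous_coe.comp (continuous_normAbs.comp ((continuous_apply w').comp hΨ))
    · exact NNReal.continuous_coe.comp (continuous_normAbs.comp ((continuous_apply w').comp hZ))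
  refine hQ.rpow_const fun p => Or.inl (ne_of_gt (lt_of_lt_of_le zero_lt_one ?_))
  exact Finset.one_le_prod (fun w' _ => le_max_left _ _)

/-! ## §2 Inert unramified places: `Q_v^{−σ} = W^{−2σ}`, `Q_v = 1` on `𝒪_v³`, and the local mean -/

include hd in
/-- **`Q_v(p)^{−σ} = max(1, max(‖p₀‖,‖p₁‖)², ‖p₂‖)^{−2σ}` AT AN INERT UNRAMIFIED PLACE** (`v ∤ 2`, `δ` a `w`-unit, `q_w = q_v²`): one place above `v`, and ★ `max_one_norm_height_eq_sq`.
[cite: Langlands1971, §3] -/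
theorem localHeight_rpow_eq_inertCell (hw : c • w.1 = w.1) (he : v.asIdeal.ramificationIdx' w.1.asIdeal = 1)
    (h2 : Valued.v (2 : v.adicCompletion F) = 1) (hδu : Valued.v (algebraMap E (LocalRing E v) δ w) = 1) (hq : w.1.residueCard = v.residueCard ^ 2)
    (σ : ℝ) (p : Fin 3 → v.adicCompletion F) :
    (∏ w' : PlacesOver E v, max 1 (max ((normAbs (w'.1.adicCompletion E) (quadraticLocalEquiv E v c hcδ hδ (p 0, p 1) w') : ℝ≥0) : ℝ)
        ((normAbs (w'.1.adicCompletion E) ((toLocalRing E v (p 2) * algebraMap E (LocalRing E v) δ -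
          toLocalRing E v 2⁻¹ * (quadraticLocalEquiv E v c hcδ hδ (p 0, p 1) * conjLocal E c v (quadraticLocalEquiv E v c hcδ hδ (p 0, p 1)))) w') : ℝ≥0) : ℝ))) ^ (-σ) =
      (max 1 (max ((max ((normAbs (v.adicCompletion F) (p 0) : ℝ≥0) : ℝ) ((normAbs (v.adicCompletion F) (p 1) : ℝ≥0) : ℝ)) ^ 2)
        ((normAbs (v.adicCompletion F) (p 2) : ℝ≥0) : ℝ))) ^ (-(2 * σ)) := by
  haveI : Subsingleton (PlacesOver E v) := PlacesOver.subsingleton_of_smul_eq c (ne_one_of_apply_eq_neg E c hcδ hδ) w hw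
  rw [Fintype.prod_subsingleton _ w, max_one_norm_height_eq_sq E c hcδ hδ hd v w hw he h2 hδu hq (p 0) (p 1) (p 2),
    ← Real.rpow_natCast_mul (le_trans zero_le_one (le_max_left _ _))]
  congr 1
  push_cast
  ring

include hd in
/-- **`Q_v = 1` ON `𝒪_v³` AT AN INERT UNRAMIFIED PLACE** (`‖p_i‖ ≤ 1` makes `W = 1`) — the `hf1` of ★ `AdelicProductIntegral` at such `v`. [cite: TateThesis1967, §3.3] -/
theorem localHeight_eq_one_of_normAbs_le_one_of_nonsplit (hw : c • w.1 = w.1) (he : v.asIdeal.ramificationIdx' w.1.asIdeal = 1)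
    (h2 : Valued.v (2 : v.adicCompletion F) = 1) (hδu : Valued.v (algebraMap E (LocalRing E v) δ w) = 1) (hq : w.1.residueCard = v.residueCard ^ 2)
    {p : Fin 3 → v.adicCompletion F} (hp : ∀ i, normAbs (v.adicCompletion F) (p i) ≤ 1) :
    (∏ w' : PlacesOver E v, max 1 (max ((normAbs (w'.1.adicCompletion E) (quadraticLocalEquiv E v c hcδ hδ (p 0, p 1) w') : ℝ≥0) : ℝ)
        ((normAbs (w'.1.adicCompletion E) ((toLocalRing E v (p 2) * algebraMap E (LocalRing E v) δ -
          toLocalRing E v 2⁻¹ * (quadraticLocalEquiv E v c hcδ hδ (p 0, p 1) * conjLocal E c v (quadraticLocalEquiv E v c hcδ hδ (p 0, p 1)))) w') : ℝ≥0) : ℝ))) = 1 := by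
  haveI : Subsingleton (PlacesOver E v) := PlacesOver.subsingleton_of_smul_eq c (ne_one_of_apply_eq_neg E c hcδ hδ) w hw
  rw [Fintype.prod_subsingleton _ w, max_one_norm_height_eq_sq E c hcδ hδ hd v w hw he h2 hδu hq (p 0) (p 1) (p 2)]
  have h0 : ((normAbs (v.adicCompletion F) (p 0) : ℝ≥0) : ℝ) ≤ 1 := by exact_mod_cast hp 0
  have h1 : ((normAbs (v.adicCompletion F) (p 1) : ℝ≥0) : ℝ) ≤ 1 := by exact_mod_cast hp 1
  have h2' : ((normAbs (v.adicCompletion F) (p 2) : ℝ≥0) : ℝ) ≤ 1 := by exact_mod_cast hp 2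
  have hM : (max ((normAbs (v.adicCompletion F) (p 0) : ℝ≥0) : ℝ) ((normAbs (v.adicCompletion F) (p 1) : ℝ≥0) : ℝ)) ^ 2 ≤ 1 := by
    have hm : max ((normAbs (v.adicCompletion F) (p 0) : ℝ≥0) : ℝ) ((normAbs (v.adicCompletion F) (p 1) : ℝ≥0) : ℝ) ≤ 1 := max_le h0 h1
    have hm0 : 0 ≤ max ((normAbs (v.adicCompletion F) (p 0) : ℝ≥0) : ℝ) ((normAbs (v.adicCompletion F) (p 1) : ℝ≥0) : ℝ) := le_max_of_le_left (NNReal.coe_nonneg _)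
    nlinarith
  rw [max_eq_left (max_le hM h2'), one_pow]

variable [MeasurableSpace (v.adicCompletion F)] [BorelSpace (v.adicCompletion F)] (ν : Measure (v.adicCompletion F)) [ν.IsAddHaarMeasure]

include hd in
/-- **INTEGRABILITY OF `Q_v^{−σ}` on `(Fin 3 → F_v, ν⊗ν⊗ν)` AT AN INERT UNRAMIFIED PLACE, `σ > 1`** (§2 + ★ `integrable_inertCell_pi`). [cite: TateThesis1967, §3.3] -/
theorem integrable_localHeight_rpow_of_nonsplit (hw : c • w.1 = w.1) (he : v.asIdeal.ramificationIdx' w.1.asIdeal = 1)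
    (h2 : Valued.v (2 : v.adicCompletion F) = 1) (hδu : Valued.v (algebraMap E (LocalRing E v) δ w) = 1) (hq : w.1.residueCard = v.residueCard ^ 2)
    {σ : ℝ} (hσ : 1 < σ) :
    Integrable (fun p : Fin 3 → v.adicCompletion F =>
      (∏ w' : PlacesOver E v, max 1 (max ((normAbs (w'.1.adicCompletion E) (quadraticLocalEquiv E v c hcδ hδ (p 0, p 1) w') : ℝ≥0) : ℝ)
        ((normAbs (w'.1.adicCompletion E) ((toLocalRing E v (p 2) * algebraMap E (LocalRing E v) δ -
          toLocalRing E v 2⁻¹ * (quadraticLocalEquiv E v c hcδ hδ (p 0, p 1) * conjLocal E c v (quadraticLocalEquiv E v c hcδ hδ (p 0, p 1)))) w') : ℝ≥0) : ℝ))) ^ (-σ))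
      (Measure.pi fun _ : Fin 3 => ν) := by
  simp_rw [localHeight_rpow_eq_inertCell E c hcδ hδ hd v w hw he h2 hδu hq σ]
  exact integrable_inertCell_pi ν hσ

include hd in
/-- **THE INERT LOCAL MEAN IN FILE 1's TOKENS**: at an inert unramified `v ∤ 2` (`δ` a unit, `q_w = q_v²`), for `σ > 1`,
`∫_{Fin 3 → F_v} Q_v(p)^{−σ} d(ν⊗ν⊗ν) = ν(𝒪_v)³ · [(1 − q^{−σ})(1 − ε q^{−σ})(1 − ε q^{−(2σ−1)})] ∕ [(1 − q^{−(σ−1)})(1 − ε q^{−(σ−1)})(1 − ε q^{−(2σ−2)})]` with `ε = −1`, `q = q_v`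
(§2 + ★ `integral_inertCell_pi_eq_localScalar`; `ε_v = −1` is ★ `valueAtUniformizer_quadraticHeckeCharCM_of_nonsplit`). [cite: Langlands1971, §3] [cite: MoeglinWaldspurger1995, IV.1.11] -/
theorem integral_localHeight_rpow_eq_localScalar_of_nonsplit (hw : c • w.1 = w.1) (he : v.asIdeal.ramificationIdx' w.1.asIdeal = 1)
    (h2 : Valued.v (2 : v.adicCompletion F) = 1) (hδu : Valued.v (algebraMap E (LocalRing E v) δ w) = 1) (hq : w.1.residueCard = v.residueCard ^ 2)
    {σ : ℝ} (hσ : 1 < σ) :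
    ∫ p : Fin 3 → v.adicCompletion F,
      (∏ w' : PlacesOver E v, max 1 (max ((normAbs (w'.1.adicCompletion E) (quadraticLocalEquiv E v c hcδ hδ (p 0, p 1) w') : ℝ≥0) : ℝ)
        ((normAbs (w'.1.adicCompletion E) ((toLocalRing E v (p 2) * algebraMap E (LocalRing E v) δ -
          toLocalRing E v 2⁻¹ * (quadraticLocalEquiv E v c hcδ hδ (p 0, p 1) * conjLocal E c v (quadraticLocalEquiv E v c hcδ hδ (p 0, p 1)))) w') : ℝ≥0) : ℝ))) ^ (-σ)
        ∂(Measure.pi fun _ : Fin 3 => ν) =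
      ν.real (primePowBall (v.adicCompletion F) 0) ^ 3 *
        ((1 - (v.residueCard : ℝ) ^ (-σ)) * (1 - (-1) * (v.residueCard : ℝ) ^ (-σ)) * (1 - (-1) * (v.residueCard : ℝ) ^ (-(2 * σ - 1))) /
          ((1 - (v.residueCard : ℝ) ^ (-(σ - 1))) * (1 - (-1) * (v.residueCard : ℝ) ^ (-(σ - 1))) * (1 - (-1) * (v.residueCard : ℝ) ^ (-(2 * σ - 2))))) := by
  simp_rw [localHeight_rpow_eq_inertCell E c hcδ hδ hd v w hw he h2 hδu hq σ]
  rw [integral_inertCell_pi_eq_localScalar ν hσ, residueFieldCard_adicCompletion_eq]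

/-! ## §3 Split places: `Q_v^{−σ}` is the Gindikin–Karpelevich integrand at `Φ(p)`; `Q_v = 1` on `𝒪_v³` -/

omit [MeasurableSpace (v.adicCompletion F)] [BorelSpace (v.adicCompletion F)] in
include hd in
/-- **`Q_v(p)^{−σ}` AT A SPLIT PLACE is `(max(1,|x|,|z|)·max(1,|y|,|z − xy|))^{−σ}`** at `(x, y, z) = (p₀ + δ_w p₁, −(p₀ − δ_w p₁), δ_w p₂ − ½(p₀ + δ_w p₁)(p₀ − δ_w p₁))`
(★ `prod_placesOver_max_one_norm_height_eq_gl3_of_split`). [cite: Langlands1971, §3] -/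
theorem localHeight_rpow_eq_gl3_of_split (hw : c • w.1 ≠ w.1) (σ : ℝ) (p : Fin 3 → v.adicCompletion F) :
    (∏ w' : PlacesOver E v, max 1 (max ((normAbs (w'.1.adicCompletion E) (quadraticLocalEquiv E v c hcδ hδ (p 0, p 1) w') : ℝ≥0) : ℝ)
        ((normAbs (w'.1.adicCompletion E) ((toLocalRing E v (p 2) * algebraMap E (LocalRing E v) δ -
          toLocalRing E v 2⁻¹ * (quadraticLocalEquiv E v c hcδ hδ (p 0, p 1) * conjLocal E c v (quadraticLocalEquiv E v c hcδ hδ (p 0, p 1)))) w') : ℝ≥0) : ℝ))) ^ (-σ) =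
      (max 1 (max ((normAbs (v.adicCompletion F) (p 0 + splitSqrt F E c hcδ hδ v w * p 1) : ℝ≥0) : ℝ)
          ((normAbs (v.adicCompletion F) (splitSqrt F E c hcδ hδ v w * p 2 - 2⁻¹ * (p 0 + splitSqrt F E c hcδ hδ v w * p 1) * (p 0 - splitSqrt F E c hcδ hδ v w * p 1)) : ℝ≥0) : ℝ)) *
        max 1 (max ((normAbs (v.adicCompletion F) (-(p 0 - splitSqrt F E c hcδ hδ v w * p 1)) : ℝ≥0) : ℝ)
          ((normAbs (v.adicCompletion F)
            ((splitSqrt F E c hcδ hδ v w * p 2 - 2⁻¹ * (p 0 + splitSqrt F E c hcδ hδ v w * p 1) * (p 0 - splitSqrt F E c hcδ hδ v w * p 1)) -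
              (p 0 + splitSqrt F E c hcδ hδ v w * p 1) * (-(p 0 - splitSqrt F E c hcδ hδ v w * p 1))) : ℝ≥0) : ℝ))) ^ (-σ) := by
  rw [prod_placesOver_max_one_norm_height_eq_gl3_of_split E c hcδ hδ hd v w hw (p 0) (p 1) (p 2)]

omit [MeasurableSpace (v.adicCompletion F)] [BorelSpace (v.adicCompletion F)] in
include hd in
/-- **`Q_v = 1` ON `𝒪_v³` AT A SPLIT PLACE** with `‖δ_w‖ ≤ 1` and `‖2⁻¹‖ ≤ 1` (all of `x, y, z, z − xy` are then integral). [cite: TateThesis1967, §3.3] -/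
theorem localHeight_eq_one_of_normAbs_le_one_of_split (hw : c • w.1 ≠ w.1) (hδ1 : normAbs (v.adicCompletion F) (splitSqrt F E c hcδ hδ v w) ≤ 1)
    (h2 : normAbs (v.adicCompletion F) (2⁻¹ : v.adicCompletion F) ≤ 1) {p : Fin 3 → v.adicCompletion F} (hp : ∀ i, normAbs (v.adicCompletion F) (p i) ≤ 1) :
    (∏ w' : PlacesOver E v, max 1 (max ((normAbs (w'.1.adicCompletion E) (quadraticLocalEquiv E v c hcδ hδ (p 0, p 1) w') : ℝ≥0) : ℝ)
        ((normAbs (w'.1.adicCompletion E) ((toLocalRing E v (p 2) * algebraMap E (LocalRing E v) δ -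
          toLocalRing E v 2⁻¹ * (quadraticLocalEquiv E v c hcδ hδ (p 0, p 1) * conjLocal E c v (quadraticLocalEquiv E v c hcδ hδ (p 0, p 1)))) w') : ℝ≥0) : ℝ))) = 1 := by
  rw [prod_placesOver_max_one_norm_height_eq_gl3_of_split E c hcδ hδ hd v w hw (p 0) (p 1) (p 2)]
  -- every entry is `𝒪_v`-integral: the non-archimedean absolute value is multiplicative and ultrametric
  have hadd : ∀ x y : v.adicCompletion F, normAbs _ x ≤ 1 → normAbs _ y ≤ 1 → normAbs (v.adicCompletion F) (x + y) ≤ 1 := fun x y hx hy =>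
    (normAbs_add_le_max x y).trans (max_le hx hy)
  have hneg : ∀ x : v.adicCompletion F, normAbs _ x ≤ 1 → normAbs (v.adicCompletion F) (-x) ≤ 1 := fun x hx => by rwa [normAbs_neg]
  have hsub : ∀ x y : v.adicCompletion F, normAbs _ x ≤ 1 → normAbs _ y ≤ 1 → normAbs (v.adicCompletion F) (x - y) ≤ 1 := fun x y hx hy => by
    rw [sub_eq_add_neg]; exact hadd _ _ hx (hneg _ hy)
  have hmul : ∀ x y : v.adicCompletion F, normAbs _ x ≤ 1 → normAbs _ y ≤ 1 → normAbs (v.adicCompletion F) (x * y) ≤ 1 := fun x y hx hy => by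
    rw [map_mul]; exact mul_le_one' hx hy
  have hx : normAbs (v.adicCompletion F) (p 0 + splitSqrt F E c hcδ hδ v w * p 1) ≤ 1 := hadd _ _ (hp 0) (hmul _ _ hδ1 (hp 1))
  have hxb : normAbs (v.adicCompletion F) (p 0 - splitSqrt F E c hcδ hδ v w * p 1) ≤ 1 := hsub _ _ (hp 0) (hmul _ _ hδ1 (hp 1))
  have hz : normAbs (v.adicCompletion F) (splitSqrt F E c hcδ hδ v w * p 2 - 2⁻¹ * (p 0 + splitSqrt F E c hcδ hδ v w * p 1) * (p 0 - splitSqrt F E c hcδ hδ v w * p 1)) ≤ 1 :=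
    hsub _ _ (hmul _ _ hδ1 (hp 2)) (hmul _ _ (hmul _ _ h2 hx) hxb)
  have hzz : normAbs (v.adicCompletion F) ((splitSqrt F E c hcδ hδ v w * p 2 - 2⁻¹ * (p 0 + splitSqrt F E c hcδ hδ v w * p 1) * (p 0 - splitSqrt F E c hcδ hδ v w * p 1)) -
      (p 0 + splitSqrt F E c hcδ hδ v w * p 1) * (-(p 0 - splitSqrt F E c hcδ hδ v w * p 1))) ≤ 1 := hsub _ _ hz (hmul _ _ hx (hneg _ hxb))
  have cast : ∀ {x : v.adicCompletion F}, normAbs (v.adicCompletion F) x ≤ 1 → ((normAbs (v.adicCompletion F) x : ℝ≥0) : ℝ) ≤ 1 := fun h => by exact_mod_cast h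
  rw [max_eq_left (max_le (cast hx) (cast hz)), max_eq_left (max_le (cast (hneg _ hxb)) (cast hzz)), one_mul]

end Summit.HodgeConjecture.HodgeConjecture.Cruxes.H413.K2E1IntertwiningLocalHeightU3

end
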